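import Literature.MathematicalPhysics.QuantumFieldTheory.Balaban1983to89.B8LeafModelZd3P2
import Literature.MathematicalPhysics.QuantumFieldTheory.Balaban1983to89.B8Prop3KLevelGamma
import Literature.MathematicalPhysics.QuantumFieldTheory.Balaban1983to89.B9SupplySockB9P3ZdGammaUnivDelta2

/-!
# `Balaban1983to89.B8Prop3PrintedZdGF3P2Gamma` — [Balaban1985RegularSpaces] PROPOSITION 3 (p. 87) AS PRINTED ON THE EDITION-δ₂ P-CARRIER
# `B8LeafModelZd3P2.zdGF3P₂` (the Hölder member of (1.36) «on Ω_j», both points of the pair in Ω_j), from dag-n06-b's both-points Prop.-3-frame socket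
# `B9SupplySockB9P3ZdGammaUnivDelta2.SockB9P3H2` AT PRINT's CLASS `towerBondsP` — D3₂, the token-swap twin of this seat's D3 `B8Prop3PrintedZdGF3PGamma` (p589707 ∕ p594697)

statement-level skeleton of published theorems with citation tags; proofs where landed; nothing here is a claim about the Yang–Mills mass gap

T. Bałaban, *Spaces of regular gauge field configurations on a lattice and gauge fixing conditions*, Commun. Math. Phys. **99** (1985) 75–102
`[Balaban1985RegularSpaces]` ("B8"): Prop. 3 p. 87 («If U₀, U₁U₀ satisfy (1.40)–(1.42) with α₀, α₁, α₂ bounded by a constant depending on d and L only,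
and α₂ satisfies the additional restriction (1.61), then U₁ satisfies (1.36)–(1.39) with B₁ = 5dLB₀, B₂(β₀) = 5dLB₀(β₀)»), (1.40)–(1.42) p. 83, (1.55)–(1.62)
pp. 86–87, (1.31) p. 82, (1.36)–(1.39) p. 82 («on Ω_j»).  T. Bałaban, *Propagators for lattice gauge theories in a background field*, Commun. Math. Phys. **99**
(1985) 389–434 `[Balaban1985BackgroundPropagators]` ("[4]"): Thm 3.3 p. 398 with (3.42)–(3.43), (3.40) p. 397.  PDF held: `paper:balaban1985-cmp99-regular-spaces-gauge-fixing`.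

CITATION HEADER (lean-in-tree rule).  Cell `pub-ymgap` (HUMAN RULING D-0062, Track A), DAG node N05 = [B8], seat `pub-ymgap-dag-n05-d` (g11; R134 row s2).
WHY THIS FILE.  LOCATED NARROWNESS №4 (dag-n06-w2 L-H1 ∕ dag-n06-b WORD-δ₂ ∕ this seat's WORDS-1 (W3), cell bus 2026-08-28): the Hölder member of (1.36) and
line 5 of (1.59) are printed over pairs with BOTH points in Ω_j ([4] (3.40)); the tree's `zdGF3.C136` ∕ `zdGF3P` (by `rfl`) and `SockB9P3` type them over the
first-point class — stronger than print on a displayed-only clause, and not suppliable by [4]'s Theorem 3.3 (a far pair at the level-`j` weight is not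
`k`-uniformly bounded).  dag-n06-b's `B9SupplySockB9P3ZdGammaUnivDelta2` (p598001) lands the both-points socket `SockB9P3H2` with its univ-road member
supplier `sockB9P3PIδ2_at_univ`; this seat's `B8LeafModelZd3P2` (p599986) the edition-δ₂ carrier `zdGF3P₂`.  THIS FILE is D3 (`prop3Printed_zdGF3P_γ` ∕
`prop3Printed_zdGF3P_map_γ`) RE-RUN token for token with `zdGF3P ↦ zdGF3P₂`, `SockB9P3 ↦ SockB9P3H2`: the estimate engines (dag-n05-w1's
`B8Prop3KLevelGamma.prop3_norms_kLevel_γ` ∕ `prop3_fifth_kLevel_γ`) are class-agnostic (the Hölder line is an abstract real `h ≤ B₀β·(…)`), so the socket's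
both-points line 5 lands verbatim in the carrier's both-points clause.  Generator `gen_d3p2.py` on the tree bytes of D3.

WHAT THIS FILE PROVES (two theorems, no `def`).
★★ `prop3Printed_zdGF3P₂_γ` ∕ ★★ `prop3Printed_zdGF3P₂_map_γ` — `B8.Prop3Printed d L C₂ inp B₀β (fun a => (zdGF3P₂ 𝔸 L β len (ι a)).toGFData2)` from
`SB9P : ∀ a, SockB9P3H2 L inp.B₀ B₀β cP β len (ι a).η (ι a).k (ι a).Ω (ι a).Λs (fun m j => towerBondsP L (ι a).Ω ((ι a).Λs m) j)` (`d, L ≥ 2`, `B₀β ≥ 0`,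
`C₂ ≥ 2097152(d+1)²L²`, `cP > 0`); the `∀ i : ZdIdx` form and the index-map form (the record instantiates `ι := (·.1.1)` on the four-law `Ω₀ = ℤᵈ` sub-index,
where dag-n06-b's `sockB9P3PIδ2_at_univ` serves the socket modulo the [4] dictionaries + `HolderAtδ2`).

HONEST SCOPE.  Assembly BY NAME; nothing of (1.59) ∕ [4] Thm 3.3 is proved — the socket is a HYPOTHESIS (N06 content; at `m ≥ 1` OPEN); `≤` where print has
`<`; `T_η ↦ ℤᵈ`.  Count-neutral; N05 NOT discharged; one finite `T⁴` programme at fixed `ε`, Bałaban as printed — nothing continuum ∕ ℝ⁴ ∕ OS ∕ mass-gap ∕ Clay.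
No `sorry`, no `def`, no `instance`, no `notation`.  Unit `pub-ymgap-dag-n05-d` (g11), 2026-08-28.
-/

noncomputable section

open NormedSpace

namespace Literature.MathematicalPhysics.QuantumFieldTheory.Balaban1983to89.B8Prop3PrintedZdGF3P2Gamma

open Complex (I)
open MatrixLog B7Prop1Explicit B7Prop2Explicit B7Prop1Local B7Eq92Concrete
open B7Prop2Explicit (C0 c2')
open B7Prop3Flat (c3)
open B8Ineq132 (covDerivFwd InAk BondTouches)
open B8Eq119TwistedAxial (Restr129 InAx)
open B8Eq184Proof (gaugeExp cfgExp)
open B8Lemma1NonAbelian (mulCfg)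
open B8Eq140Level (SideTouches)
open B8Eq146AExpansion (iEta expCfg plaqCovDeriv)
open B8Eq143PlaqExpansion (pdiv)
open B7Prop4GeneralLevels (logCovIter linCovIter)
open B8Eq155JBound (Jcur wsup)
open B8ScaledSupNorm (bondNorm msup weight Bdd)
open B8Thm2LogB (blockTop)
open B8Ineq130 (tlo thi)
open B8Eq138LandauZd (IsLandau138W IsLandau146W InR138 logCfg covLap)
open B8Prop3GaugeFixedKLevel (mem_unitaryUnits_of_mgauge_eq logField_spec inAk_congr_of_sideTouches expCfg_iEta_eq_cfgExp cfgExp_congr_at)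
open B8LeafModelZd (ZdIdx)
open B8LeafModelZd3 (zdGF3 mlogCfg mlogCfg_of_sideTouches mlogCfg_of_not)
open B9SupplySockB9P3ZdGammaUnivDelta2 (SockB9P3H2)
open B8LeafModelZd3P (zdGF3P)
open B8LeafModelZd3P2 (zdGF3P₂)
open B8TowerBondsPrinted (towerBondsP towerBondsP_box_subset_pred)
open B8Prop3KLevelGamma (prop3_norms_kLevel_γ prop3_fifth_kLevel_γ prop3_windows_γ)
open B9Eq340HolderZd (hquot AdmPair)

-- `Site` alone could resolve to the torus sites of `Setup.lean`; re-export the `ℤ^d` sites of `B7Prop1Explicit`.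
export B7Prop1Explicit (Site)

variable {d : ℕ}

section Prop3Instance

variable {𝔸 : Type} [CStarAlgebra 𝔸] [Nontrivial 𝔸]

/-- ★★ **`B8.Prop3Printed` ON THE EDITION-δ₂ P-CARRIER `zdGF3P₂` (Hölder member of (1.36) on Ω_j × Ω_j pairs), EDITION γ, FROM THE BOTH-POINTS SOCKET `SockB9P3H2`** (Proposition 3, p. 87, with (1.42) on PRINT's class (1.31)): for `d, L ≥ 2`, the leaf's
`inp : B8.B9Inputs` (`B₀ = inp.B₀`), any `B₀β ≥ 0`, any (1.61)-constant `C₂ ≥ 2097152(d+1)²·L²` (the γ remainder constant's `α₀`-free majorant,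
`B8Prop3KLevelGamma.prop3_windows_γ`), any Hölder data `β, len`, and a provider threshold `cP > 0` — MODULO, per member, the Prop.-3-frame b9 socket
`SockB9P3H2` AT PRINT's CLASS `towerBondsP L i.Ω (i.Λs m) j` (inner AND crossing bonds; [4] Thm 3.3 with (3.42)–(3.43)).  PROOF = D3's, token for token: the γ
engines: windows `prop3_windows_γ` (threshold `min cP (c∕L²)`: `α₀ ≤ c∕L² ⇒ L²α₀ ≤ c`, `α₂ ≤ c∕L² ⇒ Lα₂ ≤ c`), `prop3_norms_kLevel_γ` ∕ `prop3_fifth_kLevel_γ`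
(the four members of (1.62) in norm form + the Hölder member) with the class `Λ := towerBondsP L i.Ω (i.Λs i.k)` under the box law «box ⊂ Ω_{j−1}»
(`towerBondsP_box_subset_pred`), (1.42) = the P-carrier's `C137` VERBATIM, the pointwise (1.36)₁ member by `B8Thm2GaugeFixedKLevel.thm2_pointwise_A`.
[cite: Balaban1985RegularSpaces, Prop. 3 p.87, (1.40)–(1.42) p.83, (1.59)–(1.62) pp.86–87, (1.36)–(1.39) p.82, (1.31) p.82] -/
theorem prop3Printed_zdGF3P₂_γ (hd2 : 2 ≤ d) {L : ℕ} (hL : 2 ≤ L) (inp : B8.B9Inputs) {B₀β C₂ cP : ℝ} (hB₀β : 0 ≤ B₀β)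
    (hC₂ : 2097152 * ((d : ℝ) + 1) ^ 2 * (L : ℝ) ^ 2 ≤ C₂) (hcP : 0 < cP) (β : ℝ) (len : Site d → ℝ)
    (SB9P : ∀ i : ZdIdx d L,
      SockB9P3H2 (𝔸 := 𝔸) L inp.B₀ B₀β cP β len i.η i.k i.Ω i.Λs (fun m j => towerBondsP L i.Ω (i.Λs m) j)) :
    B8.Prop3Printed d (L : ℝ) C₂ inp B₀β (fun i : ZdIdx d L => (zdGF3P₂ 𝔸 L β len i).toGFData2) := by
  have hL1 : 1 ≤ L := le_trans (by norm_num) hL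
  have hLr : (1 : ℝ) ≤ L := by exact_mod_cast hL1
  have hL0 : (0 : ℝ) < L := by linarith
  have hB₀ : 0 ≤ inp.B₀ := inp.B₀_pos.le
  obtain ⟨cN, hcN, hwin⟩ := prop3_windows_γ hd2 hL hB₀
  refine ⟨min cP (cN / (L : ℝ) ^ 2), lt_min hcP (by positivity), ?_⟩
  intro i α₀ α₁ α₂ hα₀ hα₀c hα₁ _ hα₂ hα₂c h61 U₀ P hInA _ hPair h162 hLan h137
  have hα₀P : α₀ ≤ cP := hα₀c.trans (min_le_left _ _)
  have hα₂P : α₂ ≤ cP := hα₂c.trans (min_le_left _ _)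
  have hL2 : (0 : ℝ) < (L : ℝ) ^ 2 := by positivity
  have hα₀N : (L : ℝ) ^ 2 * α₀ ≤ cN := by
    have := hα₀c.trans (min_le_right _ _)
    rw [le_div_iff₀ hL2] at this
    linarith
  have hα₂N : (L : ℝ) * α₂ ≤ cN := by
    have h1 := hα₂c.trans (min_le_right _ _)
    rw [le_div_iff₀ hL2] at h1
    have h2 : (L : ℝ) * α₂ ≤ α₂ * (L : ℝ) ^ 2 := by
      have h3 : (L : ℝ) * α₂ * 1 ≤ (L : ℝ) * α₂ * L := mul_le_mul_of_nonneg_left hLr (by positivity)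
      nlinarith [h3]
    linarith
  obtain ⟨hα3, hα4, h16, hd5, hsmall, hc₃, hside, h50, hC⟩ := hwin α₀ α₂ hα₀ hα₀N hα₂.le hα₂N
  have hC₂' : 8 * (131072 * ((d : ℝ) + 1) ^ 2) * Real.exp (4 * (800 * ((d : ℝ) + 1) ^ 2 * ((d : ℝ) + 4)) * ((L : ℝ) ^ 2 * α₀))
      * (L : ℝ) ^ 2 ≤ C₂ :=
    hC.trans hC₂
  -- the data
  set W : Site d → Fin d → 𝔸ˣ := P.2.1 with hW_def
  have hWu : ∀ x κ, W x κ ∈ unitaryUnits 𝔸 := P.2.2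
  have hU₀ : ∀ x κ, U₀.1 x κ ∈ unitaryUnits 𝔸 := U₀.2
  set A : Site d → Fin d → 𝔸 := mlogCfg i.k i.η i.Ω W with hA_def
  -- (1.41) and self-adjointness of the canonical exponent; `W = e^{iηA}` on the `E j`
  have h41 : ∀ j, j ≤ i.k → ∀ (y : Site d) (τ : Fin d), SideTouches (i.Ω j) y τ →
      W y τ = cfgExp i.η A y τ ∧ ‖A y τ‖ ≤ α₂ * ((L : ℝ) ^ j * i.η)⁻¹ := by
    intro j hj y τ hs
    obtain ⟨hexp, -, hbd⟩ := h162 j hj (y, τ) hs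
    have hexp' : W y τ = cfgExp i.η (logCfg i.η W) y τ := hexp
    have hbd' : ‖logCfg i.η W y τ‖ ≤ 1 * α₂ * ((L : ℝ) ^ j * i.η)⁻¹ := hbd
    have hAy : A y τ = logCfg i.η W y τ := mlogCfg_of_sideTouches i.η W hj hs
    refine ⟨?_, ?_⟩
    · rw [hexp']
      exact cfgExp_congr_at i.η hAy.symm
    · rw [hAy]
      simpa only [one_mul] using hbd'
  have hAsa : ∀ y τ, IsSelfAdjoint (A y τ) := by
    intro y τ
    by_cases hmem : ∃ j, j ≤ i.k ∧ SideTouches (i.Ω j) y τ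
    · obtain ⟨j, hj, hs⟩ := hmem
      rw [hA_def, mlogCfg_of_sideTouches i.η W hj hs]
      exact (h162 j hj (y, τ) hs).2.1
    · rw [hA_def, mlogCfg_of_not i.η W fun j hj hs => hmem ⟨j, hj, hs⟩]
      exact IsSelfAdjoint.zero 𝔸
  have hA0 : ∀ (y : Site d) (τ : Fin d), (∀ j, j ≤ i.k → ¬ SideTouches (i.Ω j) y τ) → A y τ = 0 :=
    fun y τ h => mlogCfg_of_not i.η W h
  -- (1.40)₁ for `e^{iηA}U₀` by locality; the Landau clause for `e^{iηA}` by locality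
  have h40₁ : InAk L i.k i.η α₀ i.Ω (mulCfg (expCfg (iEta i.η A)) U₀.1) := by
    refine (inAk_congr_of_sideTouches L i.k i.η α₀ (V := mulCfg W U₀.1) fun j hj y τ hs => ?_).1 hPair
    show W y τ * U₀.1 y τ = expCfg (iEta i.η A) y τ * U₀.1 y τ
    rw [(h41 j hj y τ hs).1, expCfg_iEta_eq_cfgExp]
  -- the global bound and the gradient datum (bounded family)
  have hAglob : ∀ y τ, ‖A y τ‖ ≤ α₂ * i.η⁻¹ := by
    intro y τ
    by_cases hmem : ∃ j, j ≤ i.k ∧ SideTouches (i.Ω j) y τ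
    · obtain ⟨j, hj, hs⟩ := hmem
      have hLj : (1 : ℝ) ≤ (L : ℝ) ^ j := one_le_pow₀ hLr
      have hη0 : 0 < i.η := i.hη
      calc ‖A y τ‖ ≤ α₂ * ((L : ℝ) ^ j * i.η)⁻¹ := (h41 j hj y τ hs).2
        _ = α₂ * i.η⁻¹ * ((L : ℝ) ^ j)⁻¹ := by rw [mul_inv]; ring
        _ ≤ α₂ * i.η⁻¹ * 1 := by
            apply mul_le_mul_of_nonneg_left (inv_le_one_of_one_le₀ hLj) (by positivity)
        _ = α₂ * i.η⁻¹ := mul_one _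
    · rw [hA0 y τ fun j hj hs => hmem ⟨j, hj, hs⟩, norm_zero]
      have hη0 : 0 < i.η := i.hη
      positivity
  have hU₀1 : ∀ x κ, U₀.1 x κ ∈ U1 𝔸 := fun x κ => unitaryUnits_le_U1 (hU₀ x κ)
  have hgrad : ∀ (y : Site d) (κ τ : Fin d), ‖covDerivFwd i.η U₀.1 κ (fun z => A z τ) y‖ ≤ 2 * α₂ * i.η⁻¹ * i.η⁻¹ := by
    intro y κ τ
    have hη0 : 0 < i.η := i.hη
    unfold covDerivFwd
    rw [norm_smul, norm_inv, Real.norm_eq_abs, abs_of_pos hη0]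
    have h1 : ‖B7Eq78Linearization.conjR (U₀.1 y κ) (A (y + e κ) τ) - A y τ‖ ≤ α₂ * i.η⁻¹ + α₂ * i.η⁻¹ := by
      calc ‖B7Eq78Linearization.conjR (U₀.1 y κ) (A (y + e κ) τ) - A y τ‖
          ≤ ‖B7Eq78Linearization.conjR (U₀.1 y κ) (A (y + e κ) τ)‖ + ‖A y τ‖ := norm_sub_le _ _
        _ ≤ α₂ * i.η⁻¹ + α₂ * i.η⁻¹ := by
            rw [B8Ineq132.norm_conjR (hU₀1 y κ)]
            exact add_le_add (hAglob _ _) (hAglob _ _)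
    calc i.η⁻¹ * ‖B7Eq78Linearization.conjR (U₀.1 y κ) (A (y + e κ) τ) - A y τ‖ ≤ i.η⁻¹ * (α₂ * i.η⁻¹ + α₂ * i.η⁻¹) :=
        mul_le_mul_of_nonneg_left h1 (by positivity)
      _ = 2 * α₂ * i.η⁻¹ * i.η⁻¹ := by ring
  have hBg : Bdd L i.k i.η (-(2 : ℝ)) (fun j (t : Fin d × Fin d × Site d) => SideTouches (i.Ω j) t.2.2 t.2.1)
      (fun t => covDerivFwd i.η U₀.1 t.1 (fun z => A z t.2.1) t.2.2) := by
    have e2 : (-(2 : ℝ)) = -((2 : ℕ) : ℝ) := by norm_num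
    rw [e2]
    refine B8ScaledSupNorm.bdd_of_forall (c := 2 * α₂ * ((L : ℝ) ^ i.k) ^ 2) fun j hj t _ => ?_
    rw [B8ScaledSupNorm.weight_neg_natCast L i.η 2 j]
    have hLjk : (L : ℝ) ^ j ≤ (L : ℝ) ^ i.k := pow_le_pow_right₀ hLr hj
    have hLj0 : (0 : ℝ) ≤ (L : ℝ) ^ j := by positivity
    have hη0 : 0 < i.η := i.hη
    calc ((L : ℝ) ^ j * i.η) ^ 2 * ‖covDerivFwd i.η U₀.1 t.1 (fun z => A z t.2.1) t.2.2‖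
        ≤ ((L : ℝ) ^ j * i.η) ^ 2 * (2 * α₂ * i.η⁻¹ * i.η⁻¹) := mul_le_mul_of_nonneg_left (hgrad _ _ _) (by positivity)
      _ = 2 * α₂ * ((L : ℝ) ^ j) ^ 2 := by field_simp
      _ ≤ 2 * α₂ * ((L : ℝ) ^ i.k) ^ 2 := by gcongr
  set g : ℝ := msup L i.k i.η (-(2 : ℝ)) (fun j (t : Fin d × Fin d × Site d) => SideTouches (i.Ω j) t.2.2 t.2.1)
      (fun t => covDerivFwd i.η U₀.1 t.1 (fun z => A z t.2.1) t.2.2) with hg_def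
  have hg0 : 0 ≤ g := B8ScaledSupNorm.msup_nonneg L i.k i.hη.le _ _ _
  have hg : ∀ j, j ≤ i.k → ∀ (y : Site d) (κ τ : Fin d), SideTouches (i.Ω j) y τ →
      ((L : ℝ) ^ j * i.η) ^ 2 * ‖covDerivFwd i.η U₀.1 κ (fun z => A z τ) y‖ ≤ g := by
    intro j hj y κ τ hs
    have h := B8ScaledSupNorm.weight_mul_norm_le_msup hBg hj (i := (κ, τ, y)) hs
    have hw : weight L i.η (-(2 : ℝ)) j = ((L : ℝ) ^ j * i.η) ^ 2 := by
      have e2 : (-(2 : ℝ)) = -((2 : ℕ) : ℝ) := by norm_num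
      rw [e2, B8ScaledSupNorm.weight_neg_natCast L i.η 2 j]
    rw [hw] at h
    exact h
  -- the Landau clause for `e^{iηA}` and the in-edge (1.59), five lines, from the socket
  have hLanA : IsLandau138W L i.k i.η (i.Ω 0) (i.Λs i.k) U₀.1 W := hLan
  obtain ⟨h59a, h59g, h59j, h59l, h59h⟩ := SB9P i α₀ α₂ hα₀ hα₀P hα₂ hα₂P U₀.1 W hU₀ hWu hInA hPair hLanA A hAsa h41 hA0
  -- (1.42) = the P-carrier's (1.37) clause, on PRINT's class of the top truncation (inner AND crossing bonds); the γ box law «box ⊂ Ω_{j−1}»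
  have hbox : ∀ j, j ≤ i.k → ∀ c ∈ towerBondsP L i.Ω (i.Λs i.k) j, ∀ x, InBox (loK L j c.1) (bondHiK L j c.1 c.2) x → x ∈ i.Ω (j - 1) :=
    fun j _ c hc x hx => towerBondsP_box_subset_pred L i.hΩ (i.Λs i.k) hc x hx
  have h42 : ∀ j, j ≤ i.k → ∀ c ∈ towerBondsP L i.Ω (i.Λs i.k) j, ‖logCovIter L U₀.1 (iEta i.η A) j c.1 c.2‖ < 2 * d * L * α₁ := h137
  have h41' : ∀ j, j ≤ i.k → ∀ (y : Site d) (τ : Fin d), SideTouches (i.Ω j) y τ → ‖A y τ‖ ≤ α₂ * ((L : ℝ) ^ j * i.η)⁻¹ :=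
    fun j hj y τ hs => (h41 j hj y τ hs).2
  -- PROPOSITION 3 at `k` levels (n05-b), all four members, and the Hölder member
  obtain ⟨ha, hg', hj, hl⟩ := prop3_norms_kLevel_γ hd2 i.hη hL hU₀ hAsa hα₀ hα₁.le hα₂.le hg0 hα3 hα4 h16 hd5
    hsmall hc₃ hB₀ hside h50 hC₂' h61 hbox hInA h40₁ h41' hg h42 h59a h59g h59j h59l
  have hh := prop3_fifth_kLevel_γ hd2 i.hη hL hU₀ hAsa hα₀ hα₁.le hα₂.le hg0 hα3 hα4 h16 hd5 hsmall hc₃ hB₀ hB₀β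
    hside h50 hC₂' h61 hbox hInA h40₁ h41' hg h42 h59g h59h
  refine ⟨⟨fun j hj b hb => ?_, hg', hh⟩, hj, hl⟩
  -- (1.36)₁ pointwise on the `E j`, read on the logarithm
  obtain ⟨hexp, hsa, -⟩ := h162 j hj b hb
  refine ⟨hexp, hsa, ?_⟩
  have hpt := B8Thm2GaugeFixedKLevel.thm2_pointwise_A i.hη hL1 h41' ha hj (y := b.1) (τ := b.2) hb
  rw [← mlogCfg_of_sideTouches i.η W hj hb]
  exact hpt

/-- ★ **(EDITION δ₂) THE SAME OVER AN INDEX MAP `ι : J → ZdIdx d L`** — Proposition 3 AS PRINTED, `B8.Prop3Printed d L C₂ inp B₀β (fun a => (zdGF3P₂ 𝔸 L β len (ι a)).toGFData2)`,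
from the sourceless b9 socket of Proposition 3's frame over print's class DEMANDED AT THE MEMBERS `ι a` ONLY (the record instantiates `ι := (·.1.1)` on the four-law
`Ω₀ = ℤᵈ` sub-index, where the socket is the N06 lineage's content; NOT at every `ZdIdx` datum — at finite-`□₀` cube-like data (1.59)-type sockets are certified false,
dag-n05-c p572834 ∕ p576185).  Proof = `prop3Printed_zdGF3P_γ`'s, member `i ↦ ι a`, token for token (the threshold `min cP (cN ∕ L²)` is member-uniform).
[cite: Balaban1985RegularSpaces, Prop. 3 p.87, (1.40)–(1.42) p.83, (1.59)–(1.62) pp.86–87, (1.36)–(1.39) p.82, (1.31) p.82] -/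
theorem prop3Printed_zdGF3P₂_map_γ (hd2 : 2 ≤ d) {L : ℕ} (hL : 2 ≤ L) (inp : B8.B9Inputs) {B₀β C₂ cP : ℝ} (hB₀β : 0 ≤ B₀β)
    (hC₂ : 2097152 * ((d : ℝ) + 1) ^ 2 * (L : ℝ) ^ 2 ≤ C₂) (hcP : 0 < cP) (β : ℝ) (len : Site d → ℝ)
    {J : Type} (ι : J → ZdIdx d L)
    (SB9P : ∀ a : J,
      SockB9P3H2 (𝔸 := 𝔸) L inp.B₀ B₀β cP β len (ι a).η (ι a).k (ι a).Ω (ι a).Λs (fun m j => towerBondsP L (ι a).Ω ((ι a).Λs m) j)) :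
    B8.Prop3Printed d (L : ℝ) C₂ inp B₀β (fun a : J => (zdGF3P₂ 𝔸 L β len (ι a)).toGFData2) := by
  have hL1 : 1 ≤ L := le_trans (by norm_num) hL
  have hLr : (1 : ℝ) ≤ L := by exact_mod_cast hL1
  have hL0 : (0 : ℝ) < L := by linarith
  have hB₀ : 0 ≤ inp.B₀ := inp.B₀_pos.le
  obtain ⟨cN, hcN, hwin⟩ := prop3_windows_γ hd2 hL hB₀
  refine ⟨min cP (cN / (L : ℝ) ^ 2), lt_min hcP (by positivity), ?_⟩
  intro a α₀ α₁ α₂ hα₀ hα₀c hα₁ _ hα₂ hα₂c h61 U₀ P hInA _ hPair h162 hLan h137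
  have hα₀P : α₀ ≤ cP := hα₀c.trans (min_le_left _ _)
  have hα₂P : α₂ ≤ cP := hα₂c.trans (min_le_left _ _)
  have hL2 : (0 : ℝ) < (L : ℝ) ^ 2 := by positivity
  have hα₀N : (L : ℝ) ^ 2 * α₀ ≤ cN := by
    have := hα₀c.trans (min_le_right _ _)
    rw [le_div_iff₀ hL2] at this
    linarith
  have hα₂N : (L : ℝ) * α₂ ≤ cN := by
    have h1 := hα₂c.trans (min_le_right _ _)
    rw [le_div_iff₀ hL2] at h1
    have h2 : (L : ℝ) * α₂ ≤ α₂ * (L : ℝ) ^ 2 := by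
      have h3 : (L : ℝ) * α₂ * 1 ≤ (L : ℝ) * α₂ * L := mul_le_mul_of_nonneg_left hLr (by positivity)
      nlinarith [h3]
    linarith
  obtain ⟨hα3, hα4, h16, hd5, hsmall, hc₃, hside, h50, hC⟩ := hwin α₀ α₂ hα₀ hα₀N hα₂.le hα₂N
  have hC₂' : 8 * (131072 * ((d : ℝ) + 1) ^ 2) * Real.exp (4 * (800 * ((d : ℝ) + 1) ^ 2 * ((d : ℝ) + 4)) * ((L : ℝ) ^ 2 * α₀))
      * (L : ℝ) ^ 2 ≤ C₂ :=
    hC.trans hC₂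
  -- the data
  set W : Site d → Fin d → 𝔸ˣ := P.2.1 with hW_def
  have hWu : ∀ x κ, W x κ ∈ unitaryUnits 𝔸 := P.2.2
  have hU₀ : ∀ x κ, U₀.1 x κ ∈ unitaryUnits 𝔸 := U₀.2
  set A : Site d → Fin d → 𝔸 := mlogCfg (ι a).k (ι a).η (ι a).Ω W with hA_def
  -- (1.41) and self-adjointness of the canonical exponent; `W = e^{iηA}` on the `E j`
  have h41 : ∀ j, j ≤ (ι a).k → ∀ (y : Site d) (τ : Fin d), SideTouches ((ι a).Ω j) y τ →
      W y τ = cfgExp (ι a).η A y τ ∧ ‖A y τ‖ ≤ α₂ * ((L : ℝ) ^ j * (ι a).η)⁻¹ := by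
    intro j hj y τ hs
    obtain ⟨hexp, -, hbd⟩ := h162 j hj (y, τ) hs
    have hexp' : W y τ = cfgExp (ι a).η (logCfg (ι a).η W) y τ := hexp
    have hbd' : ‖logCfg (ι a).η W y τ‖ ≤ 1 * α₂ * ((L : ℝ) ^ j * (ι a).η)⁻¹ := hbd
    have hAy : A y τ = logCfg (ι a).η W y τ := mlogCfg_of_sideTouches (ι a).η W hj hs
    refine ⟨?_, ?_⟩
    · rw [hexp']
      exact cfgExp_congr_at (ι a).η hAy.symm
    · rw [hAy]
      simpa only [one_mul] using hbd'
  have hAsa : ∀ y τ, IsSelfAdjoint (A y τ) := by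
    intro y τ
    by_cases hmem : ∃ j, j ≤ (ι a).k ∧ SideTouches ((ι a).Ω j) y τ
    · obtain ⟨j, hj, hs⟩ := hmem
      rw [hA_def, mlogCfg_of_sideTouches (ι a).η W hj hs]
      exact (h162 j hj (y, τ) hs).2.1
    · rw [hA_def, mlogCfg_of_not (ι a).η W fun j hj hs => hmem ⟨j, hj, hs⟩]
      exact IsSelfAdjoint.zero 𝔸
  have hA0 : ∀ (y : Site d) (τ : Fin d), (∀ j, j ≤ (ι a).k → ¬ SideTouches ((ι a).Ω j) y τ) → A y τ = 0 :=
    fun y τ h => mlogCfg_of_not (ι a).η W h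
  -- (1.40)₁ for `e^{iηA}U₀` by locality; the Landau clause for `e^{iηA}` by locality
  have h40₁ : InAk L (ι a).k (ι a).η α₀ (ι a).Ω (mulCfg (expCfg (iEta (ι a).η A)) U₀.1) := by
    refine (inAk_congr_of_sideTouches L (ι a).k (ι a).η α₀ (V := mulCfg W U₀.1) fun j hj y τ hs => ?_).1 hPair
    show W y τ * U₀.1 y τ = expCfg (iEta (ι a).η A) y τ * U₀.1 y τ
    rw [(h41 j hj y τ hs).1, expCfg_iEta_eq_cfgExp]
  -- the global bound and the gradient datum (bounded family)
  have hAglob : ∀ y τ, ‖A y τ‖ ≤ α₂ * (ι a).η⁻¹ := by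
    intro y τ
    by_cases hmem : ∃ j, j ≤ (ι a).k ∧ SideTouches ((ι a).Ω j) y τ
    · obtain ⟨j, hj, hs⟩ := hmem
      have hLj : (1 : ℝ) ≤ (L : ℝ) ^ j := one_le_pow₀ hLr
      have hη0 : 0 < (ι a).η := (ι a).hη
      calc ‖A y τ‖ ≤ α₂ * ((L : ℝ) ^ j * (ι a).η)⁻¹ := (h41 j hj y τ hs).2
        _ = α₂ * (ι a).η⁻¹ * ((L : ℝ) ^ j)⁻¹ := by rw [mul_inv]; ring
        _ ≤ α₂ * (ι a).η⁻¹ * 1 := by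
            apply mul_le_mul_of_nonneg_left (inv_le_one_of_one_le₀ hLj) (by positivity)
        _ = α₂ * (ι a).η⁻¹ := mul_one _
    · rw [hA0 y τ fun j hj hs => hmem ⟨j, hj, hs⟩, norm_zero]
      have hη0 : 0 < (ι a).η := (ι a).hη
      positivity
  have hU₀1 : ∀ x κ, U₀.1 x κ ∈ U1 𝔸 := fun x κ => unitaryUnits_le_U1 (hU₀ x κ)
  have hgrad : ∀ (y : Site d) (κ τ : Fin d), ‖covDerivFwd (ι a).η U₀.1 κ (fun z => A z τ) y‖ ≤ 2 * α₂ * (ι a).η⁻¹ * (ι a).η⁻¹ := by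
    intro y κ τ
    have hη0 : 0 < (ι a).η := (ι a).hη
    unfold covDerivFwd
    rw [norm_smul, norm_inv, Real.norm_eq_abs, abs_of_pos hη0]
    have h1 : ‖B7Eq78Linearization.conjR (U₀.1 y κ) (A (y + e κ) τ) - A y τ‖ ≤ α₂ * (ι a).η⁻¹ + α₂ * (ι a).η⁻¹ := by
      calc ‖B7Eq78Linearization.conjR (U₀.1 y κ) (A (y + e κ) τ) - A y τ‖
          ≤ ‖B7Eq78Linearization.conjR (U₀.1 y κ) (A (y + e κ) τ)‖ + ‖A y τ‖ := norm_sub_le _ _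
        _ ≤ α₂ * (ι a).η⁻¹ + α₂ * (ι a).η⁻¹ := by
            rw [B8Ineq132.norm_conjR (hU₀1 y κ)]
            exact add_le_add (hAglob _ _) (hAglob _ _)
    calc (ι a).η⁻¹ * ‖B7Eq78Linearization.conjR (U₀.1 y κ) (A (y + e κ) τ) - A y τ‖ ≤ (ι a).η⁻¹ * (α₂ * (ι a).η⁻¹ + α₂ * (ι a).η⁻¹) :=
        mul_le_mul_of_nonneg_left h1 (by positivity)
      _ = 2 * α₂ * (ι a).η⁻¹ * (ι a).η⁻¹ := by ring
  have hBg : Bdd L (ι a).k (ι a).η (-(2 : ℝ)) (fun j (t : Fin d × Fin d × Site d) => SideTouches ((ι a).Ω j) t.2.2 t.2.1)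
      (fun t => covDerivFwd (ι a).η U₀.1 t.1 (fun z => A z t.2.1) t.2.2) := by
    have e2 : (-(2 : ℝ)) = -((2 : ℕ) : ℝ) := by norm_num
    rw [e2]
    refine B8ScaledSupNorm.bdd_of_forall (c := 2 * α₂ * ((L : ℝ) ^ (ι a).k) ^ 2) fun j hj t _ => ?_
    rw [B8ScaledSupNorm.weight_neg_natCast L (ι a).η 2 j]
    have hLjk : (L : ℝ) ^ j ≤ (L : ℝ) ^ (ι a).k := pow_le_pow_right₀ hLr hj
    have hLj0 : (0 : ℝ) ≤ (L : ℝ) ^ j := by positivity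
    have hη0 : 0 < (ι a).η := (ι a).hη
    calc ((L : ℝ) ^ j * (ι a).η) ^ 2 * ‖covDerivFwd (ι a).η U₀.1 t.1 (fun z => A z t.2.1) t.2.2‖
        ≤ ((L : ℝ) ^ j * (ι a).η) ^ 2 * (2 * α₂ * (ι a).η⁻¹ * (ι a).η⁻¹) := mul_le_mul_of_nonneg_left (hgrad _ _ _) (by positivity)
      _ = 2 * α₂ * ((L : ℝ) ^ j) ^ 2 := by field_simp
      _ ≤ 2 * α₂ * ((L : ℝ) ^ (ι a).k) ^ 2 := by gcongr
  set g : ℝ := msup L (ι a).k (ι a).η (-(2 : ℝ)) (fun j (t : Fin d × Fin d × Site d) => SideTouches ((ι a).Ω j) t.2.2 t.2.1)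
      (fun t => covDerivFwd (ι a).η U₀.1 t.1 (fun z => A z t.2.1) t.2.2) with hg_def
  have hg0 : 0 ≤ g := B8ScaledSupNorm.msup_nonneg L (ι a).k (ι a).hη.le _ _ _
  have hg : ∀ j, j ≤ (ι a).k → ∀ (y : Site d) (κ τ : Fin d), SideTouches ((ι a).Ω j) y τ →
      ((L : ℝ) ^ j * (ι a).η) ^ 2 * ‖covDerivFwd (ι a).η U₀.1 κ (fun z => A z τ) y‖ ≤ g := by
    intro j hj y κ τ hs
    have h := B8ScaledSupNorm.weight_mul_norm_le_msup hBg hj (i := (κ, τ, y)) hs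
    have hw : weight L (ι a).η (-(2 : ℝ)) j = ((L : ℝ) ^ j * (ι a).η) ^ 2 := by
      have e2 : (-(2 : ℝ)) = -((2 : ℕ) : ℝ) := by norm_num
      rw [e2, B8ScaledSupNorm.weight_neg_natCast L (ι a).η 2 j]
    rw [hw] at h
    exact h
  -- the Landau clause for `e^{iηA}` and the in-edge (1.59), five lines, from the socket
  have hLanA : IsLandau138W L (ι a).k (ι a).η ((ι a).Ω 0) ((ι a).Λs (ι a).k) U₀.1 W := hLan
  obtain ⟨h59a, h59g, h59j, h59l, h59h⟩ := SB9P a α₀ α₂ hα₀ hα₀P hα₂ hα₂P U₀.1 W hU₀ hWu hInA hPair hLanA A hAsa h41 hA0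
  -- (1.42) = the P-carrier's (1.37) clause, on PRINT's class of the top truncation (inner AND crossing bonds); the γ box law «box ⊂ Ω_{j−1}»
  have hbox : ∀ j, j ≤ (ι a).k → ∀ c ∈ towerBondsP L (ι a).Ω ((ι a).Λs (ι a).k) j, ∀ x, InBox (loK L j c.1) (bondHiK L j c.1 c.2) x → x ∈ (ι a).Ω (j - 1) :=
    fun j _ c hc x hx => towerBondsP_box_subset_pred L (ι a).hΩ ((ι a).Λs (ι a).k) hc x hx
  have h42 : ∀ j, j ≤ (ι a).k → ∀ c ∈ towerBondsP L (ι a).Ω ((ι a).Λs (ι a).k) j, ‖logCovIter L U₀.1 (iEta (ι a).η A) j c.1 c.2‖ < 2 * d * L * α₁ := h137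
  have h41' : ∀ j, j ≤ (ι a).k → ∀ (y : Site d) (τ : Fin d), SideTouches ((ι a).Ω j) y τ → ‖A y τ‖ ≤ α₂ * ((L : ℝ) ^ j * (ι a).η)⁻¹ :=
    fun j hj y τ hs => (h41 j hj y τ hs).2
  -- PROPOSITION 3 at `k` levels (n05-b), all four members, and the Hölder member
  obtain ⟨ha, hg', hj, hl⟩ := prop3_norms_kLevel_γ hd2 (ι a).hη hL hU₀ hAsa hα₀ hα₁.le hα₂.le hg0 hα3 hα4 h16 hd5
    hsmall hc₃ hB₀ hside h50 hC₂' h61 hbox hInA h40₁ h41' hg h42 h59a h59g h59j h59l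
  have hh := prop3_fifth_kLevel_γ hd2 (ι a).hη hL hU₀ hAsa hα₀ hα₁.le hα₂.le hg0 hα3 hα4 h16 hd5 hsmall hc₃ hB₀ hB₀β
    hside h50 hC₂' h61 hbox hInA h40₁ h41' hg h42 h59g h59h
  refine ⟨⟨fun j hj b hb => ?_, hg', hh⟩, hj, hl⟩
  -- (1.36)₁ pointwise on the `E j`, read on the logarithm
  obtain ⟨hexp, hsa, -⟩ := h162 j hj b hb
  refine ⟨hexp, hsa, ?_⟩
  have hpt := B8Thm2GaugeFixedKLevel.thm2_pointwise_A (ι a).hη hL1 h41' ha hj (y := b.1) (τ := b.2) hb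
  rw [← mlogCfg_of_sideTouches (ι a).η W hj hb]
  exact hpt

end Prop3Instance


end Literature.MathematicalPhysics.QuantumFieldTheory.Balaban1983to89.B8Prop3PrintedZdGF3P2Gamma

end
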